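import Summits.FinalStateConjecture.FinalStateConjecture.Theorems.ZeroEnergyKerrOrBombStationaryLimitReductionRecutCoveringJunctionCore
import HarnessLib

/-!
# Route ZeroEnergyKerrOrBomb · crux `FinalStateFromKerrOrBomb` (stmt-FinalStateConjecture-17839), line
# `SketchIdeator1` — stub `stub_recutJunctionCoreOriented`, wave 4: under the chart-overlap clause (CO) the set-level
# overlap-margin clause (iii) of `HasExhaustiveDocCharts'` becomes COORDINATE information

Helper file (`--supports stmt-FinalStateConjecture-17839`; registered helper `recutJunction_shell_mem_flatDomain`) of the
lead's wave-4 stub worker W15 (2026-08-17); companion of `…RecutPastBoundaryFlat.lean` (flat steering brick, proposed the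
same day) and of the wave-3 files p141608 / p141631 / p142043. See `work/stubs/W15-report.md`: the oriented junction core
as registered is FALSE (unbounded lag between the flat chart's time label and the hole chart's time on common events is
legal), and the repair is the chart-overlap clause (CO) "the `N + 1` late charts are restrictions of one lab-coordinate
map, injective on the late coordinate regions" (`work/stubs/sig-CO.txt`). This file records the first two consequences of
(CO) that the restated core consumes, with the relevant conjuncts of (CO) as explicit hypotheses (no definition is
introduced):

* §1 (conjunct (b), injectivity hole/flat): clause (iii) — "for late chart time `σ`, the chart image of the far shell
  `{timeᵢ = σ, radiusᵢ ≥ Rᵢ(σ − s₀) − W} ∩ docPart` lies in the radiation zone `Ψ₀({x⁰ > τ₀})`" — yields that the far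
  shell COORDINATE points themselves are flat-domain points of flat time `> τ₀` (`recutJunction_shell_mem_flatDomain`),
  and contrapositively that a late d.o.c.-part coordinate point outside the flat domain (or of flat time `≤ τ₀`) has
  radius `< Rᵢ(σ − s₀) − W` — it is DEEP inside the certified tube, for every margin (`radius_lt_of_not_mem_flatDomain`).
* §2 (conjunct (a), agreement hole/flat): a hole-chart coordinate point lying in the flat domain with lab time `> τ₀`
  (resp. `> τ₁`) is charted INTO the radiation zone (resp. the flat late region after `τ₁`, hence into every recut /
  d.o.c. certified late region) — `chart_mem_radiationZone_of_mem_flatDomain`, `chart_mem_recutCertifiedLate_of_lt`.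

Elementary; no named fact, nothing restated. Reference: Dafermos–Luk arXiv:1710.01722, Conjecture 1 (b)–(c).
-/

set_option linter.dupNamespace false

noncomputable section

open scoped Manifold ContDiff Topology ENNReal
open Set Filter Function Literature.Geometry.Lorentzian

namespace Summit.FinalStateConjecture.FinalStateConjecture.Theorems.SymplecticDualOfTheBomb

open Summit.FinalStateConjecture.FinalStateConjecture.Theorems.OneLockedExplosion

/-! ## §1 Clause (iii) in coordinates, from the injectivity conjunct (b) of (CO) -/

/-- **Registered helper `recutJunction_shell_mem_flatDomain` (stub `stub_recutJunctionCoreOriented`, wave 4).** Let `d` be a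
stationary decomposition with radii `R` satisfying the overlap-margin clause (iii) of `HasExhaustiveDocCharts'`, and assume
conjunct (b) of the chart-overlap clause (CO): a LATE hole-chart coordinate point and a LATE flat coordinate point with the
same chart image are the same coordinate point. Then for every hole `i` and margins `W, s₀`, for all late chart times `σ`,
every d.o.c.-part coordinate point `y` of hole `i` with `timeᵢ y = σ` and `radiusᵢ y ≥ Rᵢ(σ − s₀) − W` IS a flat-domain
point, of flat (lab) time `y⁰ > τ₀`: (iii) puts `chart i y` in the radiation zone `Ψ₀({x⁰ > τ₀} ∩ U₀)`, say `= Ψ₀ y'`, and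
(b) gives `y = y'`. [folklore] -/
theorem recutJunction_shell_mem_flatDomain : ∀ {𝓢 : Spacetime.{0} 4} {O : Set 𝓢.carrier} {k : ℕ} (d : StationaryFinalStateDecomposition 𝓢 O k) (R : Fin d.N → ℝ → ℝ), (∀ i, ∀ W s₀ : ℝ, ∀ᶠ σ in Filter.atTop, d.toOver.chart i '' ({x | (d.background i).time x.1 = σ ∧ R i (σ - s₀) - W ≤ (d.background i).radius x.1} ∩ docPart d i) ⊆ d.toOver.radiationZone) → (∀ (i : Fin d.N) (y : (d.background i).domain) (y' : d.toOver.flatDomain), d.toOver.τ₀ < (d.background i).time y.1 → d.toOver.τ₀ < (y' : E4) 0 → d.toOver.chart i y = d.toOver.flatChart y' → (y : E4) = y') → ∀ (i : Fin d.N) (W s₀ : ℝ), ∀ᶠ σ in Filter.atTop, ∀ y : (d.background i).domain, y ∈ docPart d i → (d.background i).time y.1 = σ → R i (σ - s₀) - W ≤ (d.background i).radius y.1 → (y : E4) ∈ (d.toOver.flatDomain : Set E4) ∧ d.toOver.τ₀ < (y : E4) 0 := by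
  intro 𝓢 O k d R hiii hb i W s₀
  filter_upwards [hiii i W s₀, eventually_gt_atTop d.toOver.τ₀] with σ hσ hστ₀ y hdoc htime hrad
  have hmem : d.toOver.chart i y ∈ d.toOver.radiationZone := hσ (mem_image_of_mem _ ⟨⟨htime, hrad⟩, hdoc⟩)
  obtain ⟨y', hy', heq⟩ := hmem
  have hlate : d.toOver.τ₀ < (d.background i).time y.1 := by rw [htime]; exact hστ₀
  have hyy' : (y : E4) = y' := hb i y y' hlate hy' heq.symm
  refine ⟨?_, ?_⟩
  · rw [hyy']; exact y'.2
  · rw [hyy']; exact hy'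

section Consequences

variable {𝓢 : Spacetime.{0} 4} {O : Set 𝓢.carrier} {k : ℕ}

/-- **Contrapositive (the form the junction consumes): late d.o.c.-part coordinate points that are NOT late flat-domain points
are deep inside the certified tube.** With (iii) and conjunct (b) of (CO), for every hole `i` and margins `W, s₀`, for late
chart times `σ`: a d.o.c.-part point `y` of chart time `σ` which is not a flat-domain point, or whose lab time is `≤ τ₀`, has
`radiusᵢ y < Rᵢ(σ − s₀) − W`. [folklore] -/
theorem radius_lt_of_not_mem_flatDomain (d : StationaryFinalStateDecomposition 𝓢 O k) (R : Fin d.N → ℝ → ℝ)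
    (hiii : ∀ i, ∀ W s₀ : ℝ, ∀ᶠ σ in atTop, d.toOver.chart i '' ({x | (d.background i).time x.1 = σ ∧
      R i (σ - s₀) - W ≤ (d.background i).radius x.1} ∩ docPart d i) ⊆ d.toOver.radiationZone)
    (hb : ∀ (i : Fin d.N) (y : (d.background i).domain) (y' : d.toOver.flatDomain), d.toOver.τ₀ < (d.background i).time y.1 →
      d.toOver.τ₀ < (y' : E4) 0 → d.toOver.chart i y = d.toOver.flatChart y' → (y : E4) = y')
    (i : Fin d.N) (W s₀ : ℝ) :
    ∀ᶠ σ in atTop, ∀ y : (d.background i).domain, y ∈ docPart d i → (d.background i).time y.1 = σ →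
      ((y : E4) ∉ (d.toOver.flatDomain : Set E4) ∨ (y : E4) 0 ≤ d.toOver.τ₀) →
      (d.background i).radius y.1 < R i (σ - s₀) - W := by
  filter_upwards [recutJunction_shell_mem_flatDomain d R hiii hb i W s₀] with σ hσ y hdoc htime hnot
  by_contra hge
  push Not at hge
  obtain ⟨hmem, hlab⟩ := hσ y hdoc htime hge
  rcases hnot with h | h
  · exact h hmem
  · exact absurd hlab (not_lt.2 h)

/-! ## §2 The agreement conjunct (a) of (CO): hole coordinates in the flat domain are charted into the flat regions -/

/-- Under conjunct (a) of (CO) (`chart i y = Ψ₀ ⟨y, h⟩` whenever the hole-chart coordinate point `y` lies in the flat domain),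
a hole-chart coordinate point in the flat domain with lab time `y⁰ > τ₀` is charted into the radiation zone. [folklore] -/
theorem chart_mem_radiationZone_of_mem_flatDomain (d : StationaryFinalStateDecomposition 𝓢 O k)
    (ha : ∀ (i : Fin d.N) (y : (d.background i).domain) (h : (y : E4) ∈ d.toOver.flatDomain),
      d.toOver.chart i y = d.toOver.flatChart ⟨y, h⟩)
    (i : Fin d.N) (y : (d.background i).domain) (h : (y : E4) ∈ d.toOver.flatDomain) (hlab : d.toOver.τ₀ < (y : E4) 0) :
    d.toOver.chart i y ∈ d.toOver.radiationZone := by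
  rw [ha i y h]
  exact mem_image_of_mem _ (show d.toOver.τ₀ < (y : E4) 0 from hlab)

/-- Under conjunct (a) of (CO), a hole-chart coordinate point in the flat domain with lab time `y⁰ > τ₁` is charted into the
flat late region after `τ₁`, hence into `recutCertifiedLate d M a Θ R' τ₁` for ALL `M a Θ R'` (its flat piece): such points
are never on the left-hand side of the junction core. [folklore] -/
theorem chart_mem_recutCertifiedLate_of_lt (d : StationaryFinalStateDecomposition 𝓢 O k)
    (ha : ∀ (i : Fin d.N) (y : (d.background i).domain) (h : (y : E4) ∈ d.toOver.flatDomain),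
      d.toOver.chart i y = d.toOver.flatChart ⟨y, h⟩)
    (M a : Fin d.N → ℝ) (Θ : Fin d.N → E4 → E4) (R' : Fin d.N → ℝ → ℝ) {τ₁ : ℝ}
    (i : Fin d.N) (y : (d.background i).domain) (h : (y : E4) ∈ d.toOver.flatDomain) (hlab : τ₁ < (y : E4) 0) :
    d.toOver.chart i y ∈ recutCertifiedLate d M a Θ R' τ₁ := by
  rw [ha i y h]
  exact Or.inl (mem_image_of_mem _ (show τ₁ < (y : E4) 0 from hlab))

/-- The same for the d.o.c.-certified late region `docCertifiedLate d R τ₁` (flat piece). [folklore] -/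
theorem chart_mem_docCertifiedLate_of_lt (d : StationaryFinalStateDecomposition 𝓢 O k)
    (ha : ∀ (i : Fin d.N) (y : (d.background i).domain) (h : (y : E4) ∈ d.toOver.flatDomain),
      d.toOver.chart i y = d.toOver.flatChart ⟨y, h⟩)
    (R : Fin d.N → ℝ → ℝ) {τ₁ : ℝ} (i : Fin d.N) (y : (d.background i).domain) (h : (y : E4) ∈ d.toOver.flatDomain)
    (hlab : τ₁ < (y : E4) 0) :
    d.toOver.chart i y ∈ docCertifiedLate d R τ₁ := by
  rw [ha i y h]
  exact Or.inl (mem_image_of_mem _ (show τ₁ < (y : E4) 0 from hlab))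

/-- Under conjunct (a) of (CO), a hole-chart coordinate point in the flat domain of lab time EXACTLY `τ₁` is charted into the
flat slab at `τ₁`, hence into `recutCertifiedSlab d M a Θ R' τ₁` for all `M a Θ R'` (the "annulus" points of the old slab at
chart time `τ₁` that are flat-domain points of lab time `τ₁` are recut certified slab points). [folklore] -/
theorem chart_mem_recutCertifiedSlab_of_eq (d : StationaryFinalStateDecomposition 𝓢 O k)
    (ha : ∀ (i : Fin d.N) (y : (d.background i).domain) (h : (y : E4) ∈ d.toOver.flatDomain),
      d.toOver.chart i y = d.toOver.flatChart ⟨y, h⟩)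
    (M a : Fin d.N → ℝ) (Θ : Fin d.N → E4 → E4) (R' : Fin d.N → ℝ → ℝ) {τ₁ : ℝ}
    (i : Fin d.N) (y : (d.background i).domain) (h : (y : E4) ∈ d.toOver.flatDomain) (hlab : (y : E4) 0 = τ₁) :
    d.toOver.chart i y ∈ recutCertifiedSlab d M a Θ R' τ₁ := by
  rw [ha i y h]
  exact Or.inl (mem_image_of_mem _ (show (y : E4) 0 = τ₁ from hlab))

end Consequences

end Summit.FinalStateConjecture.FinalStateConjecture.Theorems.SymplecticDualOfTheBomb

end
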